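import Summits.ResolutionOfSingularities.ResolutionOfSingularities.Theorems.FrobeniusLadderFRationalResolutionWildLogRegularNhd
import Summits.ResolutionOfSingularities.ResolutionOfSingularities.Theorems.FrobeniusLadderFRationalResolutionFixedChart
import Summits.ResolutionOfSingularities.ResolutionOfSingularities.Theorems.FrobeniusLadderFRationalResolutionTameEtaleLocalResolution
import Mathlib.AlgebraicGeometry.Morphisms.Etale
import HarnessLib

/-!
# Crux `FrobeniusLadder.FRationalResolution` (stmt-ResolutionOfSingularities-15317), line `redirect`,
# stub `stub_diagonalizableQuotientResolution` — **under the stub's hypothesis `hq` VERBATIM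
# (any field, any finite abelian `A`, tame or wild), EVERY point of `X` has an étale neighbourhood
# WITH A RESOLUTION OF SINGULARITIES** (brick W5' of memo MEMO-15317-leafhand2-g4: scheme-level
# assembly without tameness)

`…TameEtaleLocalResolution` needed `|A| ∈ kˣ`; `…FixedEtaleLocalResolution` needed the chart point
to be fixed. Here neither: for a chart `φ : Spec S₀ → X` (`S` regular of finite type over `k`,
graded by the finite group `A`) and `v ↦ x`, pick a prime `𝔔` of `S` over `v`, its unit-degree
subgroup `B` (`…StabilizerSubgroup`), and `t ∈ S₀ ∖ 𝔔` such that `S_t` has global homogeneous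
units in all degrees of `B` (`…AwayUnits`); `S_t` is again regular of finite type, graded by `A`
(`locPiece`), with `(S_t)_0 = (S₀)_t` étale over `S₀` (`…FixedChart.etale_locPieceZeroHom`). The
ring-level theorem `…WildLogRegularNhd.exists_hasResolution_away_of_units` gives `g ∈ (S_t)_0`
outside `𝔔 S_t` with `Spec ((S_t)_0)_g` resolvable, and `Spec ((S_t)_0)_g → Spec (S_t)_0 →
Spec S₀ → X` is the étale neighbourhood.

* `exists_chart_hasResolution_away` — ring level: an étale `S₀ → R`, a prime `w` of `R` over
  `v`, and `g ∉ w` with `Spec R_g` resolvable;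
* **`exists_etale_nhd_hasResolution_of_hq`** — the statement of the title.

Honest label: the CEILING of the log-regular line WITHOUT tameness — étale-local resolvability of
every point under `hq`, all fields; NOT the stub: `Scheme.HasResolution X` needs these local
resolutions to GLUE (functorial resolution of locally toric schemes / Bergh–Rydh destackification —
XL, open in print for imperfect non-f.g. `k`). No definitions, no named facts, no sorry.
[cite: Kato1994, (10.4)] [folklore; cite: SGA3, Exp. VIII §4–5; EGAII, (2.2.1)–(2.2.2)]
-/

noncomputable section

-- single-problem summit: the doubled namespace component is forced
set_option linter.dupNamespace false

open CategoryTheory AlgebraicGeometry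
open Literature.RingTheory.GradedAlgebra
open Literature.AlgebraicGeometry.Resolution
open Literature.AlgebraicGeometry.Resolution.DiagonalizableQuotient

namespace Summit.ResolutionOfSingularities.ResolutionOfSingularities.Theorems.FRationalResolution.EtaleLocalResolution

/-- **Ring level: every point of `Spec S₀` has, after an étale localization, a resolvable basic
open neighbourhood.** `S` regular of finite type over the field `k`, graded by the finite abelian
group `A`; `v` a point of `Spec S₀`. There are an étale ring map `j : S₀ → R` (namely
`S₀ → (S_t)_0 = (S₀)_t`), a prime `w` of `R` over `v` and `g ∈ R ∖ w` such that `Spec R_g` has a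
resolution of singularities. [cite: Kato1994, (10.4)] [folklore; cite: SGA3, Exp. VIII §4–5] -/
theorem exists_chart_hasResolution_away (k : Type) [Field k] (A : Type) [AddCommGroup A]
    [Finite A] [DecidableEq A] (S : Type) [CommRing S] [Algebra k S] (𝒮 : A → Submodule k S)
    [GradedAlgebra 𝒮] [Algebra.FiniteType k S] [IsRegularRing S] (v : Spec (.of (𝒮 0))) :
    ∃ (R : Type) (_ : CommRing R) (j : 𝒮 0 →+* R), j.Etale ∧
      ∃ w : PrimeSpectrum R, w.asIdeal.comap j = v.asIdeal ∧
        ∃ g : R, g ∉ w.asIdeal ∧ Scheme.HasResolution (Spec (.of (Localization.Away g))) := by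
  classical
  have hA : AddMonoid.IsTorsion A := fun a => isOfFinAddOrder_of_finite a
  -- a prime of `S` over `v` and its unit-degree subgroup
  obtain ⟨wS, hwS⟩ := comap_algebraMap_gradeZero_surjective 𝒮 hA v
  let 𝔔 : Ideal S := wS.asIdeal
  haveI h𝔔prime : 𝔔.IsPrime := wS.isPrime
  have h𝔔v : 𝔔.comap (algebraMap (𝒮 0) S) = v.asIdeal := by
    have h := congrArg PrimeSpectrum.asIdeal hwS
    rwa [PrimeSpectrum.comap_asIdeal] at h
  obtain ⟨B, hB, -⟩ := StabilizerSubgroup.exists_unitDegrees_addSubgroup 𝒮 hA 𝔔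
  -- localize away from one degree-zero element: global units in the degrees of `B`
  obtain ⟨t, ht0, -, hT, hloc⟩ := AwayUnits.exists_away_units (k := k) 𝒮 𝔔 B hB
  let L : Type := Localization.Away t
  obtain ⟨hprime, hcomap, hBL, -, hunitL⟩ := hloc L
  let ℒ : A → Submodule k L := locPiece 𝒮 (Submonoid.powers t) hT L
  letI instℒ : GradedAlgebra ℒ := (nonempty_gradedAlgebra_locPiece 𝒮 _ hT L).some
  set 𝔔L : Ideal L := 𝔔.map (algebraMap S L) with h𝔔L
  haveI : 𝔔L.IsPrime := hprime
  haveI : Algebra.FiniteType k L := by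
    show Algebra.FiniteType k (Localization (Submonoid.powers t))
    infer_instance
  haveI : IsRegularRing L := isRegularRing_localization (Submonoid.powers t)
  -- the ring-level neighbourhood theorem for `S_t` at `𝔔 S_t`
  obtain ⟨g, hg, hres⟩ :=
    WildLogRegularNhd.exists_hasResolution_away_of_units ℒ 𝔔L B hBL hunitL
  -- the étale localization on degree zero
  let j : 𝒮 0 →+* ℒ 0 := locPieceZeroHom 𝒮 (Submonoid.powers t) hT L
  have hjval : ∀ s, (j s : L) = algebraMap S L s := fun s => rfl
  have hjet : j.Etale := FixedChart.etale_locPieceZeroHom 𝒮 ht0 hT L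
  let w : PrimeSpectrum (ℒ 0) := ⟨𝔔L.comap (algebraMap (ℒ 0) L), inferInstance⟩
  have hw : w.asIdeal.comap j = v.asIdeal := by
    show (𝔔L.comap (algebraMap (ℒ 0) L)).comap j = v.asIdeal
    rw [Ideal.comap_comap, ← h𝔔v, ← hcomap, Ideal.comap_comap]
    congr 1
  refine ⟨ℒ 0, inferInstance, j, hjet, w, hw, g, ?_, hres⟩
  show g ∉ 𝔔L.comap (algebraMap (ℒ 0) L)
  rw [Ideal.mem_comap]
  exact hg

/-- **Diagonalizable quotient singularities with regular charts are étale-locally resolvable —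
every field, tame or wild.** Under the hypothesis `hq` of `stub_diagonalizableQuotientResolution`
verbatim, every `x ∈ X` has an étale neighbourhood `ψ : Spec T → X`, `x ∈ ψ(Spec T)`, with
`Scheme.HasResolution (Spec T)`. [cite: Kato1994, (10.4)]
[folklore; cite: SGA1, Exp. I Prop. 7.6; SGA3, Exp. VIII §4–5] -/
theorem exists_etale_nhd_hasResolution_of_hq (k : Type) [Field k] (X : Scheme.{0})
    (g : X ⟶ Spec (.of k))
    (hq : ∀ x : X, ∃ (A : Type) (_ : AddCommGroup A) (_ : Finite A) (_ : DecidableEq A)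
        (S : Type) (_ : CommRing S) (_ : Algebra k S) (𝒮 : A → Submodule k S)
        (_ : GradedAlgebra 𝒮), Algebra.FiniteType k S ∧ IsRegularRing S ∧
        ∃ φ : Spec (.of (𝒮 0)) ⟶ X, Etale φ ∧ x ∈ Set.range φ ∧
          φ ≫ g = Spec.map (CommRingCat.ofHom (algebraMap k (𝒮 0))))
    (x : X) :
    ∃ (T : Type) (_ : CommRing T) (ψ : Spec (.of T) ⟶ X),
      Etale ψ ∧ x ∈ Set.range ψ ∧ Scheme.HasResolution (Spec (.of T)) := by
  classical
  obtain ⟨A, _, _, _, S, _, _, 𝒮, _, hft, hreg, φ, hφ, ⟨v, hv⟩, -⟩ := hq x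
  haveI := hft
  haveI := hreg
  haveI := hφ
  obtain ⟨R, _, j, hjet, w, hw, g', hg', hres⟩ := exists_chart_hasResolution_away k A S 𝒮 v
  haveI : Etale (Spec.map (CommRingCat.ofHom j)) :=
    (HasRingHomProperty.Spec_iff (P := @Etale)).mpr hjet
  let φ' : Spec (.of R) ⟶ X := Spec.map (CommRingCat.ofHom j) ≫ φ
  have hw' : Spec.map (CommRingCat.ofHom j) w = v := by
    apply PrimeSpectrum.ext
    rw [Spec.map_apply, PrimeSpectrum.comap_asIdeal]
    exact hw
  have hφ'w : φ' w = x := by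
    show φ (Spec.map (CommRingCat.ofHom j) w) = x
    rw [hw', hv]
  rw [← hφ'w]
  exact TameEtaleLocalResolution.exists_etale_nhd_of_away g' φ' w hg' hres

end Summit.ResolutionOfSingularities.ResolutionOfSingularities.Theorems.FRationalResolution.EtaleLocalResolution

end
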